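import Literature.AlgebraicGeometry.Motives.MumfordTateInvariantsTensorFormBasis
import HarnessLib

/-!
# The induced polarization of `T^{a,b}` (Mumford–Tate invariants, step 17)

For a polarization `Q` of a pure `ℚ`-Hodge structure `H` of weight `n` on a finite-dimensional
`V`, the induced form `Q_T = Q^{⊗a} ⊗ (Q^∨)^{⊗b}` (`Polarization.tensorForm`) is a polarization of
the Hodge structure `T^{a,b} H = H^{⊗a} ⊗ (H^∨)^{⊗b}` of weight `(a-b) n`
(`Polarization.tensorSpace`): it is `(-1)^{(a-b)n}`-symmetric (`Polarization.tensorForm_flip`),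
satisfies the first Hodge–Riemann relation `Q_{T,ℂ}(F^p, F^{w+1-p}) = 0`
(`Polarization.tensorForm_apply_eq_zero`) and the second one,
`i^{P-Q'} Q_{T,ℂ}(x, conj x) > 0` for `0 ≠ x ∈ T^{P,Q'}` (`Polarization.tensorForm_pos`), both read
off in the tensor basis of an `h`-orthonormal graded basis of `V_ℂ`
(`MumfordTateInvariantsTensorFormBasis`). This is the statement "tensor constructions of
polarized Hodge structures are polarized" (Deligne, *Théorie de Hodge II*, 2.1.15 with
1.1.12; Green–Griffiths–Kerr, *Mumford–Tate groups and domains*, I.A), which feeds the tree's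
semisimplicity theorem `SubHodgeStructure.exists_isCompl_eq_orthogonal` (Voisin 2002, Lemma 7.26)
in the proof of `Deligne1982_mumfordTateInvariants` (ii).

## References

* P. Deligne, *Théorie de Hodge II*, Publ. Math. IHÉS 40 (1971), 1.1.12, 2.1.15.
* C. Voisin, *Hodge Theory and Complex Algebraic Geometry I* (2002), §7.1.2, Lemma 7.26.
-/

noncomputable section

open scoped TensorProduct
open PiTensorProduct Complex

namespace Literature.AlgebraicGeometry.Motives

namespace HodgeStructure

universe u

variable {V : Type u} [AddCommGroup V] [Module ℚ V] [Module.Finite ℚ V] {n : ℤ}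
  {H : HodgeStructure V n}

/-! ### Symmetry -/

/-- `Q^∨(ψ, φ) = (-1)^n Q^∨(φ, ψ)`. [folklore] -/
theorem Polarization.dualForm_swap (Q : Polarization H) (φ ψ : Module.Dual ℚ V) :
    Q.dualForm ψ φ = ((n.negOnePow : ℤˣ) : ℤ) * Q.dualForm φ ψ := by
  rw [Q.dualForm_apply, Q.dualForm_apply, Q.form_swap]

omit [Module.Finite ℚ V] in
/-- `(-1)^{k n} = ((-1)^n)^k` for `k : ℕ`, as rational numbers. [folklore] -/
theorem cast_negOnePow_natCast_mul (k : ℕ) (n : ℤ) :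
    (((((k : ℤ) * n).negOnePow : ℤˣ) : ℤ) : ℚ) = ((((n.negOnePow : ℤˣ) : ℤ) : ℚ)) ^ k := by
  induction k with
  | zero => simp
  | succ k ih =>
    rw [Nat.cast_succ, add_mul, one_mul, Int.negOnePow_add, Units.val_mul, Int.cast_mul, ih, pow_succ]

omit [Module.Finite ℚ V] in
/-- `(-1)^{(a-b) n} = ((-1)^n)^a ((-1)^n)^b`, as rational numbers. [folklore] -/
theorem cast_negOnePow_sub_mul (a b : ℕ) (n : ℤ) :
    ((((((a : ℤ) - b) * n).negOnePow : ℤˣ) : ℤ) : ℚ) =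
      (((n.negOnePow : ℤˣ) : ℤ) : ℚ) ^ a * (((n.negOnePow : ℤˣ) : ℤ) : ℚ) ^ b := by
  rw [sub_mul, Int.negOnePow_sub, Units.val_mul, Int.cast_mul, cast_negOnePow_natCast_mul,
    cast_negOnePow_natCast_mul]

/-- **`Q_T` is `(-1)^{(a-b)n}`-symmetric.** [folklore] -/
theorem Polarization.tensorForm_flip (Q : Polarization H) (a b : ℕ) :
    (Q.tensorForm a b).flip = (((((a : ℤ) - b) * n).negOnePow : ℤˣ) : ℤ) • Q.tensorForm a b := by
  refine bilinForm_ext_tprod fun v w φ ψ => ?_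
  rw [LinearMap.BilinForm.flip_apply, LinearMap.smul_apply, LinearMap.smul_apply,
    Polarization.tensorForm, tensorForm_tmul_tprod, tensorForm_tmul_tprod]
  have h1 : ∏ k, Q.form (w k) (v k) = ∏ k, (((n.negOnePow : ℤˣ) : ℤ) * Q.form (v k) (w k)) :=
    Finset.prod_congr rfl fun k _ => Q.form_swap (v k) (w k)
  have h2 : ∏ l, Q.dualForm (ψ l) (φ l) = ∏ l, (((n.negOnePow : ℤˣ) : ℤ) * Q.dualForm (φ l) (ψ l)) :=
    Finset.prod_congr rfl fun l _ => Q.dualForm_swap (φ l) (ψ l)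
  rw [h1, h2, Finset.prod_mul_distrib, Finset.prod_mul_distrib, Finset.prod_const, Finset.prod_const,
    Finset.card_univ, Fintype.card_fin, Finset.card_univ, Fintype.card_fin]
  rw [zsmul_eq_mul, cast_negOnePow_sub_mul]
  ring

/-! ### Values on spans of basis vectors -/

omit [Module.Finite ℚ V] in
/-- A bilinear form vanishing on `E '' X × E '' Y` vanishes on `span (E '' X) × span (E '' Y)`.
[folklore] -/
theorem bilinForm_eq_zero_of_mem_span {K : Type*} [Field K] {M : Type*} [AddCommGroup M] [Module K M]
    {ι : Type*} (B : LinearMap.BilinForm K M) (E : ι → M) (X Y : Set ι)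
    (h : ∀ i ∈ X, ∀ j ∈ Y, B (E i) (E j) = 0) {x y : M} (hx : x ∈ Submodule.span K (E '' X))
    (hy : y ∈ Submodule.span K (E '' Y)) : B x y = 0 := by
  induction hx using Submodule.span_induction with
  | mem x hx' =>
    obtain ⟨i, hi, rfl⟩ := hx'
    induction hy using Submodule.span_induction with
    | mem y hy' =>
      obtain ⟨j, hj, rfl⟩ := hy'
      exact h i hi j hj
    | zero => simp
    | add y z _ _ hy hz => rw [map_add, hy, hz, add_zero]
    | smul c y _ hy => rw [map_smul, hy, smul_zero]
  | zero => simp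
  | add x z _ _ hx hz => rw [map_add, LinearMap.add_apply, hx, hz, add_zero]
  | smul c x _ hx => rw [map_smul, LinearMap.smul_apply, hx, smul_zero]

variable [HodgeTensorFacts.{u, u}]

/-- **First Hodge–Riemann relation for `Q_T`**: `Q_{T,ℂ}(F^p T, F^{w+1-p} T) = 0`, `w = (a-b) n`.
[folklore] -/
theorem Polarization.tensorForm_apply_eq_zero (Q : Polarization H) (a b : ℕ) (p : ℤ)
    (x : ℂ ⊗[ℚ] hodgeTensorSpace V a b) (hx : x ∈ (H.tensorSpace a b).F p)
    (y : ℂ ⊗[ℚ] hodgeTensorSpace V a b)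
    (hy : y ∈ (H.tensorSpace a b).F (((a : ℤ) - b) * n + 1 - p)) :
    (Q.tensorForm a b).baseChange ℂ x y = 0 := by
  obtain ⟨S, _, _, deg, e, hF, -, he, hon⟩ := Q.exists_orthonormal_graded_basis
  rw [tensorSpace_F_eq_span H e hF] at hx hy
  refine bilinForm_eq_zero_of_mem_span _ _ _ _ (fun i hi j hj => ?_) hx hy
  simp only [Set.mem_setOf_eq] at hi hj
  exact Q.tensorFormC_basis_basis e hon he (by omega)

/-- The Hodge piece `T^{P, w-P}` of `T^{a,b}` is the span of the tensor basis vectors of total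
degree `P`. [folklore] -/
theorem tensorSpace_piece_eq_span (H : HodgeStructure V n) {S : Type u} [Fintype S] [DecidableEq S]
    {deg : S → ℤ} (e : Module.Basis S ℂ (ℂ ⊗[ℚ] V))
    (hF : ∀ a, H.F a = Submodule.span ℂ (e '' {σ | a ≤ deg σ}))
    (hFc : ∀ a, complexConj (H.F a) = Submodule.span ℂ (e '' {σ | deg σ ≤ n - a})) (a b : ℕ)
    {P Q' : ℤ} (hPQ : P + Q' = ((a : ℤ) - b) * n) :
    (H.tensorSpace a b).piece P Q' =
      Submodule.span ℂ (hodgeTensorBasisBC e a b '' {x | tensorDegree deg x = P}) := by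
  rw [piece_of_add_eq _ hPQ, tensorSpace_F_eq_span H e hF, complexConj_tensorSpace_F_eq_span H e hFc,
    span_basis_image_inf]
  congr 2
  ext x
  simp only [Set.mem_inter_iff, Set.mem_setOf_eq]
  omega

/-- **Second Hodge–Riemann relation for `Q_T`**: `i^P (i^{Q'})⁻¹ Q_{T,ℂ}(x, conj x)` is a positive
real for `0 ≠ x ∈ T^{P,Q'}`, `P + Q' = (a-b) n`. In the tensor basis of an `h`-orthonormal graded
basis, `x = Σ c_k E k` over `k` of degree `P`, and the quantity is `Σ |c_k|²`. [folklore] -/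
theorem Polarization.tensorForm_pos (Q : Polarization H) (a b : ℕ) (P Q' : ℤ)
    (hPQ : P + Q' = ((a : ℤ) - b) * n) (x : ℂ ⊗[ℚ] hodgeTensorSpace V a b)
    (hx : x ∈ (H.tensorSpace a b).piece P Q') (hx0 : x ≠ 0) :
    ∃ r : ℝ, 0 < r ∧ Complex.I ^ P * (Complex.I ^ Q')⁻¹ *
      (Q.tensorForm a b).baseChange ℂ x (conj x) = r := by
  obtain ⟨S, _, _, deg, e, hF, hFc, he, hon⟩ := Q.exists_orthonormal_graded_basis
  rw [tensorSpace_piece_eq_span H e hF hFc a b hPQ] at hx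
  obtain ⟨c, hc⟩ : ∃ c : (Fin a → S) × (Fin b → S) → ℂ, ∀ k, c k = (hodgeTensorBasisBC e a b).repr x k :=
    ⟨_, fun _ => rfl⟩
  have hsupp : ∀ k, c k ≠ 0 → tensorDegree deg k = P := by
    intro k hk
    have h := (Module.Basis.mem_span_image (hodgeTensorBasisBC e a b)).1 hx
    rw [hc] at hk
    exact h (Finsupp.mem_support_iff.2 hk)
  -- expand `x` and `conj x`
  have hxsum : x = ∑ k, c k • hodgeTensorBasisBC e a b k := by
    simp_rw [hc]
    exact ((hodgeTensorBasisBC e a b).sum_repr x).symm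
  have hconj : conj x = ∑ k, starRingEnd ℂ (c k) • conj (hodgeTensorBasisBC e a b k) := by
    conv_lhs => rw [hxsum]
    rw [map_sum]
    simp_rw [conj_smul]
  have hval : (Q.tensorForm a b).baseChange ℂ x (conj x) =
      ∑ k, c k * starRingEnd ℂ (c k) *
        ((∏ i, (hodgeSign n (deg (k.1 i)))⁻¹) * ∏ l, hodgeSign n (deg (k.2 l))) := by
    rw [hconj]
    conv_lhs => rw [hxsum]
    simp_rw [map_sum, LinearMap.sum_apply, map_smul, LinearMap.smul_apply, smul_eq_mul,
      Q.tensorFormC_basis_conj_basis e hon, mul_ite, mul_zero]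
    refine Finset.sum_congr rfl fun k _ => ?_
    rw [Finset.sum_eq_single k (fun m _ hmk => by rw [if_neg hmk]) (fun h => absurd (Finset.mem_univ k) h),
      if_pos rfl]
    ring
  have hsign : Complex.I ^ P * (Complex.I ^ Q')⁻¹ = hodgeSign (((a : ℤ) - b) * n) P := by
    rw [hodgeSign, show ((a : ℤ) - b) * n - P = Q' by omega]
  refine ⟨∑ k, Complex.normSq (c k), ?_, ?_⟩
  · -- positivity: some coefficient is non-zero
    have hne : ∃ k, c k ≠ 0 := by
      by_contra hall
      simp only [not_exists, not_not] at hall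
      apply hx0
      rw [hxsum]
      simp [hall]
    obtain ⟨k, hk⟩ := hne
    exact Finset.sum_pos' (fun i _ => Complex.normSq_nonneg _)
      ⟨k, Finset.mem_univ _, Complex.normSq_pos.2 hk⟩
  · rw [hsign, hval, Finset.mul_sum, Complex.ofReal_sum]
    refine Finset.sum_congr rfl fun k _ => ?_
    by_cases hk : c k = 0
    · simp [hk]
    · have hs := hodgeSign_mul_tensorSign (n := n) deg k
      rw [hsupp k hk] at hs
      rw [← Complex.mul_conj]
      linear_combination (c k * starRingEnd ℂ (c k)) * hs

/-- **The induced polarization of `T^{a,b} H`**: `Q_T = Q^{⊗a} ⊗ (Q^∨)^{⊗b}` polarizes the tensor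
Hodge structure `H^{⊗a} ⊗ (H^∨)^{⊗b}` (the standard fact that duals and tensor products of
polarized Hodge structures are polarized by the induced forms; Deligne, Hodge II, 2.1.15 for the
notion; GGK, *Mumford–Tate groups and domains*, I.A). [folklore] -/
def Polarization.tensorSpace (Q : Polarization H) (a b : ℕ) : Polarization (H.tensorSpace a b) where
  form := Q.tensorForm a b
  flip_form := Q.tensorForm_flip a b
  form_apply_eq_zero p x hx y hy := Q.tensorForm_apply_eq_zero a b p x hx y hy
  pos P Q' hPQ x hx hx0 := Q.tensorForm_pos a b P Q' hPQ x hx hx0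

/-- The form of the induced polarization is `Q_T`. [folklore] -/
@[simp]
theorem Polarization.tensorSpace_form (Q : Polarization H) (a b : ℕ) :
    (Q.tensorSpace a b).form = Q.tensorForm a b :=
  rfl

/-- In particular every tensor space of a polarizable Hodge structure is polarizable. [folklore] -/
theorem IsPolarizable.tensorSpace (hH : H.IsPolarizable) (a b : ℕ) :
    (H.tensorSpace a b).IsPolarizable := by
  obtain ⟨Q⟩ := hH
  exact ⟨Q.tensorSpace a b⟩

end HodgeStructure

end Literature.AlgebraicGeometry.Motives

end
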